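import Mathlib
import HarnessLib
import Summits.SmoothPoincare4.SmoothPoincare4.Theses.SymplecticOrigami
import Literature.AlgebraicTopology.SingularHomology.PoincareDuality
import Literature.AlgebraicTopology.SingularHomology.CupProduct
import Literature.AlgebraicTopology.SingularHomology.Orientation

/-!
# Sketch — crux-ideate stmt-SmoothPoincare4-7842 (NoGenusTwoDoor), ideator 3, round 1

First lemmas of the two idea cards (signatures only; proofs are not attempted here):

* `cupProduct_H1_eq_zero_of_b2_eq_one` (card `albanese-isotropic-pencil`): on a closed
  `ℝ`-oriented 4-manifold with `b₂(ℝ) = 1` the real cup product `H¹ × H¹ → H²` vanishes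
  identically — the common root of: vanishing Li–Liu wall-crossing, `Q_ω ≡ 0` (total failure of
  hard Lefschetz in degree 1), degree-0 Albanese map, isotropic monodromy-invariant plane of every
  Lefschetz pencil on a door.
* `door_has_symplectic_genus_two_surface` (card `semidefinite-filling-door`): a door carries an
  embedded symplectic genus-2 surface (Taubes SW = Gr in the canonical class, chamber-free because
  of the previous lemma); its complement is the exact, intersection-form-zero filling of the
  genus-2 Boothby–Wang link on which the card's filling-rigidity lever acts.
* `NoSymplecticGenusTwoAtBTwoOne` — the closed-manifold shadow of the card's transfer `C⁺`
  ("no strong filling of (Y_{2,-1}, ξ_BW) with vanishing rational intersection form"), typed over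
  existing declarations: no closed symplectic 4-manifold with `b₂ = 1` contains an embedded
  symplectic genus-2 surface; and the implication to the crux.
-/

open scoped Manifold ContDiff
open Literature.AlgebraicTopology.SingularHomology

namespace Summit.SmoothPoincare4.SmoothPoincare4.Cruxes.NoGenusTwoDoor.Ideator3

/-- FIRST LEMMA (card `albanese-isotropic-pencil`). Closed connected `ℝ`-oriented topological
4-manifold with `b₂(N; ℝ) = 1` ⇒ `a ⌣ b = 0` for all `a b ∈ H¹(N; ℝ)`.
Proof sketch: `(a ⌣ b) ⌣ (a ⌣ b) = ± (a ⌣ a) ⌣ (b ⌣ b) = 0` (graded commutativity over `ℝ`),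
while the cup pairing `H² × H² → H⁴ ≅ ℝ` is perfect (`isPerfPair_cupPairing_of_field`) and
`H²(N; ℝ)` is a line, so a square-zero class is zero. -/
theorem cupProduct_H1_eq_zero_of_b2_eq_one
    (N : Type) [TopologicalSpace N] [T2Space N] [SecondCountableTopology N] [CompactSpace N]
    [ConnectedSpace N] [ChartedSpace (EuclideanSpace ℝ (Fin 4)) N]
    (μ : HomologicalOrientation ℝ N 4)
    (hPD : isPerfPair_cupPairing_of_field (X := N) μ (show 2 + 2 = 4 by norm_num))
    (hcomm : cupProduct_gradedComm ℝ N)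
    (hb2 : bettiNumber ℝ N 2 = 1) :
    ∀ a b : singularCohomology ℝ ℝ N 1,
      cupProduct (X := N) (show 1 + 1 = 2 by norm_num) a b = 0 := by
  sorry

/-- FIRST LEMMA (card `semidefinite-filling-door`): the Taubes step. A door — closed connected
symplectic `(N, s)` with `rank H₁ = 2`, `rank H₂ = 1` — contains a smoothly embedded compact
connected surface of genus 2 (`rank H₁(S) = 4`) with `s`-symplectic image.
(Taubes SW ⇒ Gr for the canonical class; no chamber issue since the wall-crossing number is a
multiple of `a ⌣ b = 0`; connectedness and genus from `K² = K·K = 1`, adjunction.) -/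
theorem door_has_symplectic_genus_two_surface
    (N : Type) [TopologicalSpace N] [T2Space N] [SecondCountableTopology N] [CompactSpace N]
    [ConnectedSpace N] [ChartedSpace (EuclideanSpace ℝ (Fin 4)) N] [IsManifold (𝓡 4) ∞ N]
    (s : Literature.Geometry.Kaehler.MForm (𝓡 4) N ℝ 2)
    (hs : Literature.Geometry.Kaehler.IsSmoothForm s) (hc : Literature.Geometry.Kaehler.IsClosedForm s)
    (hnd : ∀ x (v : TangentSpace (𝓡 4) x), v ≠ 0 → ∃ w, s x ![v, w] ≠ 0)
    (hb1 : Module.finrank ℤ (Literature.Topology.FourManifolds.singularHomologyZ N 1) = 2)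
    (hb2 : Module.finrank ℤ (Literature.Topology.FourManifolds.singularHomologyZ N 2) = 1) :
    ∃ (S : Type) (_ : TopologicalSpace S) (_ : T2Space S) (_ : CompactSpace S) (_ : ConnectedSpace S)
      (_ : ChartedSpace (EuclideanSpace ℝ (Fin 2)) S) (_ : IsManifold (𝓡 2) ∞ S) (b : S → N),
      Module.finrank ℤ (Literature.Topology.FourManifolds.singularHomologyZ S 1) = 4 ∧
      Manifold.IsSmoothEmbedding (𝓡 2) (𝓡 4) ∞ b ∧
      (∀ y (v : TangentSpace (𝓡 2) y), v ≠ 0 →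
        ∃ w : TangentSpace (𝓡 2) y,
          s (b y) ![mfderiv (𝓡 2) (𝓡 4) b y v, mfderiv (𝓡 2) (𝓡 4) b y w] ≠ 0) := by
  sorry

/-- Closed-manifold shadow of the TRANSFER `C⁺` of card `semidefinite-filling-door`:
no closed connected symplectic 4-manifold with `rank H₂ = 1` contains a smoothly embedded
compact connected genus-2 surface with symplectic image. (Equivalent, by gluing/removing the
standard concave genus-2 cap of square `+1`, to: the Boothby–Wang contact structure on the
Euler-number `-1` circle bundle over `Σ₂` has no strong symplectic filling with identically
vanishing rational intersection form.) -/
def NoSymplecticGenusTwoAtBTwoOne : Prop :=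
  ∀ (N : Type) [TopologicalSpace N] [T2Space N] [SecondCountableTopology N] [CompactSpace N]
    [ConnectedSpace N] [ChartedSpace (EuclideanSpace ℝ (Fin 4)) N] [IsManifold (𝓡 4) ∞ N]
    (s : Literature.Geometry.Kaehler.MForm (𝓡 4) N ℝ 2),
    Literature.Geometry.Kaehler.IsSmoothForm s → Literature.Geometry.Kaehler.IsClosedForm s →
    (∀ x (v : TangentSpace (𝓡 4) x), v ≠ 0 → ∃ w, s x ![v, w] ≠ 0) →
    Module.finrank ℤ (Literature.Topology.FourManifolds.singularHomologyZ N 2) = 1 →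
    ∀ (S : Type) [TopologicalSpace S] [T2Space S] [CompactSpace S] [ConnectedSpace S]
      [ChartedSpace (EuclideanSpace ℝ (Fin 2)) S] [IsManifold (𝓡 2) ∞ S] (b : S → N),
      Module.finrank ℤ (Literature.Topology.FourManifolds.singularHomologyZ S 1) = 4 →
      Manifold.IsSmoothEmbedding (𝓡 2) (𝓡 4) ∞ b →
      ¬ (∀ y (v : TangentSpace (𝓡 2) y), v ≠ 0 →
        ∃ w : TangentSpace (𝓡 2) y,
          s (b y) ![mfderiv (𝓡 2) (𝓡 4) b y v, mfderiv (𝓡 2) (𝓡 4) b y w] ≠ 0)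

/-- The transfer closes the crux: `C⁺ →` (Taubes step) `→ NoGenusTwoDoor`. Pure logic given
`door_has_symplectic_genus_two_surface`. -/
theorem noGenusTwoDoor_of_noSymplecticGenusTwo (h : NoSymplecticGenusTwoAtBTwoOne) :
    Summit.SmoothPoincare4.SmoothPoincare4.Theses.SymplecticOrigami.NoGenusTwoDoor := by
  intro N _ _ _ _ _ _ _ s hs hc hnd ⟨hb1, hb2⟩
  obtain ⟨S, _, _, _, _, _, _, b, hS, hb, hsymp⟩ :=
    door_has_symplectic_genus_two_surface N s hs hc hnd hb1 hb2
  exact h N s hs hc hnd hb2 S b hS hb hsymp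

end Summit.SmoothPoincare4.SmoothPoincare4.Cruxes.NoGenusTwoDoor.Ideator3
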